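import Summits.CriticalPhenomena.PercolationContinuityZ3.Theorems.PercNearOneGluingNoHeavyLowerTailSahiGridPatternCanalysing

/-!
# `NoHeavyLowerTail` (crux stmt-CriticalPhenomena-4575), Sahi programme: nested-canalysing sets are closed under CYLINDERS
# (irrelevant coordinates) — the step needed for pull-backs / the measure-level corollary

Support file (seat `prim-sahi-p1`, generation 9; `--supports stmt-CriticalPhenomena-4575`).  Pure proofs, no definitions, no `sorry`,
standard axioms.

`IsCanalysing.cylinder`: if `D ⊆ [3]^n` is nested canalysing then so is the cylinder `D × [3] = canalLift D 0 3` (excluded as a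
CONSTRUCTOR because the cylinder over an arbitrary good set has no instance-blind lift, but DERIVABLE for canalysing `D`: the free
coordinate commutes down to the base `[3]^k / ∅`).  Ingredients: one-coordinate decisions commute with permutations of the inner
coordinates (`canalLift_map_compEquivD`) and two decisions on different new coordinates commute up to the swap of those coordinates
(`canalLift_canalLift_zero_three`).  Consequence: pull-backs of nested-canalysing sets along monotone coordinate maps (which turn a decision
into a decision or a cylinder) stay nested canalysing — the input for the grid / product-measure form of `sStarD_nonneg_of_isCanalysing`
(orthant and co-orthant cases: `latticeE3_gridProd_nonneg_orthant`, `latticeE3_gridProd_nonneg_coorthant`). [this work]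
-/

namespace Summit.CriticalPhenomena.PercolationContinuityZ3.Theorems.SahiGridPattern

open Finset SahiGrid3
open scoped BigOperators

variable {n : ℕ}

/-- The extension of a permutation of `Fin d` to `Fin (d+1)` fixing the last index (`Equiv.Perm.extendDomain` along
`finSuccAboveEquiv (Fin.last d)`) fixes the last index. [this work] -/
theorem extendLast_last {d : ℕ} (τ : Equiv.Perm (Fin d)) :
    (τ.extendDomain (finSuccAboveEquiv (Fin.last d))) (Fin.last d) = Fin.last d :=
  Equiv.Perm.extendDomain_apply_not_subtype _ _ (by simp)

/-- … and acts as `τ` on the initial indices. [this work] -/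
theorem extendLast_castSucc {d : ℕ} (τ : Equiv.Perm (Fin d)) (j : Fin d) :
    (τ.extendDomain (finSuccAboveEquiv (Fin.last d))) (Fin.castSucc j) = Fin.castSucc (τ j) := by
  have h1 : Fin.castSucc j = ((finSuccAboveEquiv (Fin.last d)) j : Fin (d + 1)) := by
    simp [finSuccAboveEquiv_apply, Fin.succAbove_last]
  rw [h1, Equiv.Perm.extendDomain_apply_image]
  simp [finSuccAboveEquiv_apply, Fin.succAbove_last]

/-- Membership in a one-coordinate decision, coordinate form. [this work] -/
theorem mem_canalLift (D : Finset (Pd n)) (t s : ℕ) (x : Pd (n + 1)) :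
    x ∈ canalLift D t s ↔ (s ≤ ((x (Fin.last n) : Fin 3) : ℕ) ∨ (t ≤ ((x (Fin.last n) : Fin 3) : ℕ) ∧ (fun b => x (Fin.castSucc b)) ∈ D)) := by
  unfold canalLift; rw [Finset.mem_filter]; simp

/-- One-coordinate decisions commute with permutations of the inner coordinates. [this work] -/
theorem canalLift_map_compEquivD {d : ℕ} (A : Finset (Pd d)) (τ : Equiv.Perm (Fin d)) (t s : ℕ) :
    canalLift (A.map (compEquivD τ).toEmbedding) t s =
      (canalLift A t s).map (compEquivD (τ.extendDomain (finSuccAboveEquiv (Fin.last d)))).toEmbedding := by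
  ext x
  rw [mem_canalLift, Finset.mem_map_equiv, Finset.mem_map_equiv, mem_canalLift]
  have e1 : ((compEquivD (τ.extendDomain (finSuccAboveEquiv (Fin.last d)))).symm x) (Fin.last d) = x (Fin.last d) := by
    show x ((τ.extendDomain (finSuccAboveEquiv (Fin.last d))).symm (Fin.last d)) = x (Fin.last d)
    rw [Equiv.Perm.extendDomain_symm, extendLast_last]
  have e2 : (fun b => ((compEquivD (τ.extendDomain (finSuccAboveEquiv (Fin.last d)))).symm x) (Fin.castSucc b)) =
      (compEquivD τ).symm (fun b => x (Fin.castSucc b)) := by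
    funext b
    show x ((τ.extendDomain (finSuccAboveEquiv (Fin.last d))).symm (Fin.castSucc b)) = x (Fin.castSucc (τ.symm b))
    rw [Equiv.Perm.extendDomain_symm, extendLast_castSucc]
  rw [e1, e2]

/-- Two decisions on two new coordinates: the cylinder over a decision is the swap-image of the decision over the cylinder. [this work] -/
theorem canalLift_canalLift_zero_three (D : Finset (Pd n)) (t s : ℕ) :
    canalLift (canalLift D t s) 0 3 =
      (canalLift (canalLift D 0 3) t s).map
        (compEquivD (Equiv.swap (Fin.castSucc (Fin.last n)) (Fin.last (n + 1)))).toEmbedding := by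
  ext x
  set τ : Equiv.Perm (Fin (n + 2)) := Equiv.swap (Fin.castSucc (Fin.last n)) (Fin.last (n + 1)) with hτ
  rw [mem_canalLift, Finset.mem_map_equiv, mem_canalLift, mem_canalLift]
  have lt1 : ((x (Fin.last (n + 1)) : Fin 3) : ℕ) < 3 := (x (Fin.last (n + 1))).isLt
  have hne : Fin.castSucc (Fin.last n) ≠ Fin.last (n + 1) := by
    intro h; have := congrArg Fin.val h; simp at this
  have eL : ((compEquivD τ).symm x) (Fin.last (n + 1)) = x (Fin.castSucc (Fin.last n)) := by
    show x (τ.symm (Fin.last (n + 1))) = _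
    rw [hτ, Equiv.symm_swap, Equiv.swap_apply_right]
  have eM : ((compEquivD τ).symm x) (Fin.castSucc (Fin.last n)) = x (Fin.last (n + 1)) := by
    show x (τ.symm (Fin.castSucc (Fin.last n))) = _
    rw [hτ, Equiv.symm_swap, Equiv.swap_apply_left]
  have eI : (fun b => ((compEquivD τ).symm x) (Fin.castSucc (Fin.castSucc b))) = fun c => x (Fin.castSucc (Fin.castSucc c)) := by
    funext c
    show x (τ.symm (Fin.castSucc (Fin.castSucc c))) = _
    rw [hτ, Equiv.symm_swap, Equiv.swap_apply_of_ne_of_ne]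
    · intro h; have := congrArg Fin.val h; simp at this; have := c.isLt; omega
    · intro h; have := congrArg Fin.val h; simp at this; have := c.isLt; omega
  rw [mem_canalLift, eL, eM, eI]
  have lt2 : ((x (Fin.last (n + 1)) : Fin 3) : ℕ) < 3 := lt1
  constructor
  · rintro (h | ⟨_, h⟩)
    · exfalso; omega
    · rcases h with h | ⟨h1, h2⟩
      · left; exact h
      · right; exact ⟨h1, Or.inr ⟨Nat.zero_le _, h2⟩⟩
  · rintro (h | ⟨h1, h2⟩)
    · right; exact ⟨Nat.zero_le _, Or.inl h⟩
    · rcases h2 with h2 | ⟨_, h2⟩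
      · exfalso; omega
      · right; exact ⟨Nat.zero_le _, Or.inr ⟨h1, h2⟩⟩

/-- **Nested-canalysing sets are closed under cylinders**: `D` nested canalysing ⇒ `D × [3] = canalLift D 0 3` nested canalysing.
[this work] -/
theorem IsCanalysing.cylinder {d : ℕ} {D : Finset (Pd d)} (hD : IsCanalysing D) : IsCanalysing (canalLift D 0 3) := by
  induction hD with
  | univ d =>
    have e : canalLift (Finset.univ : Finset (Pd d)) 0 3 = Finset.univ := by
      ext x; rw [mem_canalLift]; simp
    rw [e]; exact IsCanalysing.univ (d + 1)
  | empty d =>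
    have e : canalLift (∅ : Finset (Pd d)) 0 3 = ∅ := by
      ext x; rw [mem_canalLift]
      simp only [Finset.notMem_empty, and_false, or_false, iff_false, not_le]
      exact (x (Fin.last d)).isLt
    rw [e]; exact IsCanalysing.empty (d + 1)
  | lift t s hts h ih =>
    rw [canalLift_canalLift_zero_three]
    exact IsCanalysing.perm _ (IsCanalysing.lift t s hts ih)
  | orTop hD' =>
    rename_i n D'
    rw [canalLift_canalLift_zero_three]
    exact IsCanalysing.perm _ (IsCanalysing.orTop (isUpperSet_canalLift hD' 0 3))
  | perm τ h ih =>
    rw [canalLift_map_compEquivD]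
    exact IsCanalysing.perm _ ih

/-- Iterated cylinders: `D × [3]^k` is nested canalysing when `D` is. [this work] -/
theorem IsCanalysing.cylinder_iter {d : ℕ} {D : Finset (Pd d)} (hD : IsCanalysing D) :
    ∀ k : ℕ, IsCanalysing (Nat.rec (motive := fun k => Finset (Pd (d + k))) D (fun _ E => canalLift E 0 3) k)
  | 0 => hD
  | k + 1 => IsCanalysing.cylinder (IsCanalysing.cylinder_iter hD k)

end Summit.CriticalPhenomena.PercolationContinuityZ3.Theorems.SahiGridPattern
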